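/-
Copyright (c) 2026. All rights reserved.
Released under Apache 2.0 license as described in the file LICENSE.
Authors: HodgeCM publication cell (pub-hodgecm), GR lane, seat GR-2 (`pub-hodgecm-own-hyp34`).
-/
import Literature.NumberTheory.Weil1964.AdelicMetaplecticGenerators
import Literature.NumberTheory.Weil1964.AdelicMetaplecticKernel
import Literature.NumberTheory.Automorphic.AdeleRingSymplecticGeneration
import Literature.RepresentationTheory.HeisenbergGroup.SchrodingerPiGeneration
import HarnessLib

/-!
# Every adelic symplectic automorphism is implemented on `𝒮(𝐀_Fⁿ)`: `π : Mp_ψ(W_𝐀)ᶜᵒⁿᵗ → Sp(W_𝐀)` is onto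

Topic `NumberTheory/Weil1964`; namespace `Literature.NumberTheory.Weil1964`.  KERNEL ONLY: theorems, no definition,
nothing of [Weil1964] asserted.

[Weil1964, Chap. III n° 37 p. 188]: the adelic metaplectic group `Mp(X)_A` surjects onto `Sp(X)_A`, i.e. EVERY adelic
symplectic automorphism `g` carries an operator `M` on `𝒮(X_A)` with `M ρ(h) M⁻¹ = ρ(g h)` (an automorphism of the
topological vector space `𝒮(X_A)`, Chap. I n° 11–13).  In the tree's model — `adelicMp F (Fin n) T = Mp_ψ(W_𝐀)`, the
group of ALL implementing pairs on the smooth model `𝒮(𝐀_Fⁿ) = piSchwartzBruhat F (Fin n)` for the Gram matrix `T`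
(`IsUnit T.det`), and its subgroup of record `adelicMpCont F (Fin n) T` of LF-continuous implementers
(`AdelicMetaplecticContinuous`) — this is

* **`adelicMpCont.proj_surjective`**: `adelicMpCont.proj F (Fin n) T : Mp_ψ(W_𝐀)ᶜᵒⁿᵗ → Sp(W_𝐀, β_T)` is surjective
  (and `adelicMp_proj_surjective` for the algebraic group of all pairs);
* `existsImplementer_adelicSchrodinger`: the hypothesis `ExistsImplementer` of `LocalWeilProjective` for the adelic model;
* **`adelicMpCont.isCentralExt`**: with `AdelicMetaplecticKernel` (`ker π = ℂˣ·(1, id)`, central) the printed exact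
  sequence "`0 → ℂ* → Mp_𝐀(W) →π Sp_𝐀(W) → 0`" of [GelbartRogawski1991, §3.1 p. 454 L26–27] — [Weil1964, Chap. III n° 37
  p. 188 L18–20] "elle est surjective et a pour noyau le groupe `{e} × T`" — holds for the tree's metaplectic group of
  record: `1 → ℂˣ → Mp_ψ(W_𝐀)ᶜᵒⁿᵗ → Sp(W_𝐀) → 1` is a central extension (`IsCentralExt`, the typing of
  [MoeglinVignerasWaldspurger1987, Chap. 2 II.1 (B)]).

Proof: `AdelicMetaplecticGenerators` exhibits LF-continuous implementing pairs over the three kinds of Siegel generators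
for ALL adelic parameters — `leviPair a` (`a ∈ GL_n(𝐀_F)`), `unipPair c` (`c ∈ Sym_n(𝐀_F)`), `weylPair` (self-dual Haar
measure); `AdeleRingSymplecticGeneration.range_le_of_generators_mem_adeleRing'` (the adele ring has the big-cell shift
property, so `Sp_{2n}(𝐀_F) = ⟨m, v, J⟩`) and the surjectivity of the Darboux transport
`Sp_{2n}(𝐀_F) → Sp(W_𝐀, β_T)` (`SchrodingerPiGeneration.transportSp_surjective`) conclude.  Consequence for the printed
[GelbartRogawski1991, Prop. 3.1.1] (sequel `GelbartRogawski1991/Prop311PrintedDarbouxLegsOfLeg`): ONE `Mp` leg over ONE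
adelic Darboux frame gives legs over all of them (`Prop311PrintedDarbouxLegsTransport`).

## References
* [Weil1964] A. Weil, Acta Math. 111 (1964) 143–211, Chap. I n° 11–13, Chap. III n° 37 p. 188.
* [MoeglinVignerasWaldspurger1987] C. Mœglin, M.-F. Vignéras, J.-L. Waldspurger, LNM 1291 (1987), Chap. 2 II.1, II.5–II.6.
* [GelbartRogawski1991] S. Gelbart, J. Rogawski, Invent. Math. 105 (1991), §3.1 p. 454 L21–27.
-/

set_option autoImplicit false

noncomputable section

open scoped Matrix
open NumberField MeasureTheory

namespace Literature.NumberTheory.Weil1964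

open Literature.NumberTheory.Automorphic Literature.RepresentationTheory.HeisenbergGroup
  Literature.RepresentationTheory.HeisenbergGroup.SymplecticMatrix

variable (F : Type) [Field F] [NumberField F] {n : ℕ}
variable (T : Matrix (Fin n) (Fin n) (AdeleRing (𝓞 F) F)) (hT : IsUnit T.det)

include hT in
/-- **the transport of every adelic symplectic MATRIX is implemented by an LF-continuous pair**: the range of
`Sp_{2n}(𝐀_F) → Sp(W_𝐀, β_T)` lies in the range of `π : Mp_ψ(W_𝐀)ᶜᵒⁿᵗ → Sp(W_𝐀, β_T)` — generators `m(a)`, `v(c)`, `J` go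
to `π(leviPair a)`, `π(unipPair c)`, `π(weylPair)`, and `Sp_{2n}(𝐀_F) = ⟨m, v, J⟩`.
[cite: Weil1964, Chap. I n° 13 p. 160, Chap. III n° 37 p. 188; MoeglinVignerasWaldspurger1987, Chap. 2 II.5–II.6] -/
theorem range_transportSp_le_range_proj :
    (transportSp T hT).range ≤ (adelicMpCont.proj F (Fin n) T).range := by
  letI : MeasurableSpace (AdeleRing (𝓞 F) F) := borel _
  haveI : BorelSpace (AdeleRing (𝓞 F) F) := ⟨rfl⟩
  obtain ⟨ν, hνH, hν⟩ := exists_haar_measure_piFundamentalDomain_eq_one F (n := n)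
  refine range_le_of_generators_mem_adeleRing' F (transportSp T hT) (K := (adelicMpCont.proj F (Fin n) T).range)
    (fun a => ?_) (fun c hc => ?_) ?_
  · exact ⟨⟨leviPair F T hT a, leviPair_mem_adelicMpCont F T hT a⟩,
      (proj_leviPair F T hT a).trans (transportSp_levi T hT a).symm⟩
  · exact ⟨⟨unipPair F T hT c hc, unipPair_mem_adelicMpCont F T hT c hc⟩,
      (proj_unipPair F T hT c hc).trans (transportSp_low T hT c hc).symm⟩
  · exact ⟨⟨weylPair F T hT ν hν, weylPair_mem_adelicMpCont F T hT ν hν⟩,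
      (proj_weylPair F T hT ν hν).trans (transportSp_J T hT).symm⟩

include hT in
/-- **[Weil1964, Chap. III n° 37]: `π : Mp_ψ(W_𝐀)ᶜᵒⁿᵗ → Sp(W_𝐀)` is SURJECTIVE** — every adelic symplectic automorphism
of `W_𝐀 = 𝐀_Fⁿ × 𝐀_Fⁿ` (Gram matrix `T`, `IsUnit T.det`) has an LF-continuous implementer on `𝒮(𝐀_Fⁿ)`.
[cite: Weil1964, Chap. III n° 37 p. 188; MoeglinVignerasWaldspurger1987, Chap. 2 II.1] -/
theorem adelicMpCont.proj_surjective : Function.Surjective (adelicMpCont.proj F (Fin n) T) := by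
  intro g
  obtain ⟨A, hA⟩ := Literature.RepresentationTheory.HeisenbergGroup.transportSp_surjective T hT g
  have hmem : g ∈ (adelicMpCont.proj F (Fin n) T).range :=
    range_transportSp_le_range_proj F T hT ⟨A, hA⟩
  exact hmem

include hT in
/-- the range of `π` on `Mp_ψ(W_𝐀)ᶜᵒⁿᵗ` is everything. [cite: Weil1964, Chap. III n° 37 p. 188] -/
theorem adelicMpCont.range_proj : (adelicMpCont.proj F (Fin n) T).range = ⊤ :=
  MonoidHom.range_eq_top.2 (adelicMpCont.proj_surjective F T hT)

include hT in
/-- every `g ∈ Sp(W_𝐀)` has an LF-continuous implementing pair over it. [cite: Weil1964, Chap. III n° 37 p. 188] -/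
theorem exists_mem_adelicMpCont_proj_eq (g : symplecticGroup (polar (adelicForm F (Fin n) T))) :
    ∃ p : adelicMp F (Fin n) T, p ∈ adelicMpCont F (Fin n) T ∧ MpPsi.proj (adelicSchrodinger F (Fin n) T) p = g := by
  obtain ⟨q, hq⟩ := adelicMpCont.proj_surjective F T hT g
  exact ⟨q, q.2, hq⟩

include hT in
/-- **`π : Mp_ψ(W_𝐀) → Sp(W_𝐀)` is surjective** on the algebraic group of ALL implementing pairs as well (every `g` is
implemented — `ExistsImplementer` for the adelic Schrödinger representation).
[cite: Weil1964, Chap. III n° 37 p. 188; MoeglinVignerasWaldspurger1987, Chap. 2 II.1] -/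
theorem adelicMp_proj_surjective : Function.Surjective (MpPsi.proj (adelicSchrodinger F (Fin n) T)) := by
  intro g
  obtain ⟨p, -, hp⟩ := exists_mem_adelicMpCont_proj_eq F T hT g
  exact ⟨p, hp⟩

include hT in
/-- **implementers exist for the adelic Schrödinger representation** (`ExistsImplementer`, the hypothesis of
[MoeglinVignerasWaldspurger1987, Chap. 2 II.1 (A)] for the model `𝒮(𝐀_Fⁿ)`): every `g ∈ Sp(W_𝐀)` has an `M` with
`M ρ(h) M⁻¹ = ρ(g h)`. [cite: Weil1964, Chap. III n° 37 p. 188; MoeglinVignerasWaldspurger1987, Chap. 2 II.1 (A)] -/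
theorem existsImplementer_adelicSchrodinger : ExistsImplementer (adelicSchrodinger F (Fin n) T) := by
  intro g
  refine (adelicMp_proj_surjective F T hT g).elim fun p hp => ?_
  rw [MpPsi.proj_apply] at hp
  subst hp
  exact ⟨_, (mem_MpPsi _ _).1 p.2⟩

include hT in
/-- **the exact sequence `1 → ℂˣ → Mp_ψ(W_𝐀)ᶜᵒⁿᵗ →π Sp(W_𝐀) → 1` of the metaplectic group of record is a central
extension**: "*The projection `π((g, M_g)) = g` yields an exact sequence `0 → ℂ* → Mp_𝐀(W) → Sp_𝐀(W) → 0`*"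
[GelbartRogawski1991, p. 454 L26–27]; "*elle est surjective et a pour noyau le groupe `{e} × T`*" [Weil1964, p. 188 L18–20]
— centrality and `ker π ⊆ ℂˣ·(1, id)` from `AdelicMetaplecticKernel`, surjectivity from `adelicMpCont.proj_surjective`.
[cite: Weil1964, Chap. III n° 37 p. 188 L18–20; GelbartRogawski1991, §3.1 p. 454 L26–27;
MoeglinVignerasWaldspurger1987, Chap. 2 II.1 (B)] -/
theorem adelicMpCont.isCentralExt :
    Literature.RepresentationTheory.MoeglinVignerasWaldspurger1987.IsCentralExt
      (adelicMpCont.ofScalar F (Fin n) T) (adelicMpCont.proj F (Fin n) T) :=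
  ⟨fun c => adelicMpCont.ofScalar_mem_center c,
    fun p hp => (adelicMpCont.proj_eq_one_iff ((Matrix.isUnit_iff_isUnit_det T).2 hT) p).1 hp,
    adelicMpCont.proj_surjective F T hT⟩

/-- the standard form `T = 1`: `π : Mp_ψ(𝐀ⁿ × 𝐀ⁿ, std)ᶜᵒⁿᵗ → Sp(𝐀ⁿ × 𝐀ⁿ, std)` is surjective (the group of the `Mp` legs
of the printed [GelbartRogawski1991, Prop. 3.1.1]). [cite: Weil1964, Chap. III n° 37 p. 188] -/
theorem adelicMpCont.proj_one_surjective :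
    Function.Surjective (adelicMpCont.proj F (Fin n) (1 : Matrix (Fin n) (Fin n) (AdeleRing (𝓞 F) F))) :=
  adelicMpCont.proj_surjective F (1 : Matrix (Fin n) (Fin n) (AdeleRing (𝓞 F) F))
    (by rw [Matrix.det_one]; exact isUnit_one)

end Literature.NumberTheory.Weil1964

end
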